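import Mathlib
import Literature.AlgebraicGeometry.Motives.HodgeStructure
import HarnessLib

/-!
# K1Q line `mechanism-v2`: the JET-SPAN clause of the member certificates LCERT₄ ∕ LCERT_{≥6} forces every class paired to zero
# with the 2-form frame to be `τ²`-INVARIANT (hidden Noether–Lefschetz content of the certificate)

Route `HodgeConjecture/Q8SymplecticPowers`, crux K1Q `VeryGeneralQuaternionCommutatorsInHg` (stmt-HodgeConjecture-24190). Helper
(`--supports stmt-HodgeConjecture-24190 --as helper`; nothing here closes an item; no definition; no named fact). Pure linear algebra
and calculus; it isolates what the registered stubs `stub_memberLocalCertificateQ4` ∕ `stub_memberLocalCertificateQge6` demand of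
the certified member `b` through their clause

  `∀ φ : Module.Dual ℂ (H² ⊗ ℂ), (∀ i ≤ r, iteratedFDeriv ℂ i (fun z ↦ φ (ω z)) (ψ b) = 0) → ∀ m ∈ ker(A_b ⊗ ℂ − i), φ m = 0`

(«the jets of the frame `ω` at `b` span the `i`-eigenspace `Mb` of `A_b = τ_b^*` on ALL of `H²(X_b; ℂ)`»). THEOREM
(`sq_apply_eq_self_of_jetSpan`): let `Qf` be a bilinear form on a `ℚ`-space `V`, non-degenerate on the right, `A` a `Qf`-isometry with
`A⁴ = 1`, `ω : ℂ^N → ℂ ⊗ V` any map, `U ∋ z₀` open, and suppose the clause above holds at `z₀` for the `i`-eigenspace of `A ⊗ ℂ`; then every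
`E ∈ V` with `Qf_ℂ(ω z, 1 ⊗ E) = 0` for all `z ∈ U` satisfies `A(A E) = E`. PROOF: the functional `φ_E = Qf_ℂ(·, 1 ⊗ E)` kills `ω` near
`z₀`, so all its jets vanish and the clause gives `φ_E = 0` on `ker(A_ℂ − i)`; complex conjugation (`HodgeStructure.conj`, which fixes
`1 ⊗ E`, commutes with `A ⊗ ℂ` and conjugates `Qf_ℂ`) gives `φ_E = 0` on `ker(A_ℂ + i)`; for `v` with `A²v = −v` the vector `1 ⊗ v` is
`(y + ȳ)/2` with `y = 1 ⊗ v − i·A_ℂ(1 ⊗ v) ∈ ker(A_ℂ − i)`, so `Qf(v, E) = 0`; writing `E₋ = E − A²E` (so `A²E₋ = −E₋`) the isometry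
gives `Qf(x, E₋) = 0` for `x` in both eigenspaces of `A²`, hence for all `x`, hence `E₋ = 0`.

READING FOR THE LINE (why this matters; not formalised here): in the family of the stub, `Qf = tr ∘ cup` on `H²(X_b; ℚ)`, `A = τ_b^*`,
`ω(z) ∈ F²H²(X_{ψ⁻¹ z})` transported to `b`, and `Qf_ℂ(ω z, E) = 0` holds for every rational class `E` whose transports stay of Hodge type
`(1,1)` over `W₀` (`F² ⟂ H^{1,1}`) — every class of the generic Néron–Severi group of the chosen model, every exceptional class of a fibrewise
resolution or of a `Q₈`-equivariant blow-up along sections. So the certificate exists only at a model whose generically-algebraic classes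
are ALL `τ²`-invariant («N ≤ ker(A² − 1)», clause (iv) of skeleton v6, found false for blown-up models in v9): the `∃`-form of the stubs is
essential, the `∀`-over-families form of the member data is false, and the numerical certificate at an explicit member presupposes
`ρ⁻ = 0` for the generic member of the model — an input of IRR type, not a finite computation.

Honest scope: an unconditional algebraic lemma; LCERT₄, LCERT_{≥6}, K1Q and HC are NOT proved here.
-/

set_option linter.dupNamespace false

noncomputable section

open TensorProduct Topology
open Literature.AlgebraicGeometry.Motives

namespace Summit.HodgeConjecture.HodgeConjecture.Theorems.Q8SymplecticPowersJetSpanForcesInvariant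

variable {V : Type} [AddCommGroup V] [Module ℚ V]

/-- Complex conjugation `conj ⊗ id` conjugates the complexified bilinear form: `Qf_ℂ(x̄, ȳ) = conj (Qf_ℂ(x, y))` (the base change of a
rational form is defined over `ℝ`). [cite: VoisinHodgeI2002, §7.1.1] -/
theorem baseChange_conj_conj (Qf : LinearMap.BilinForm ℚ V) (x y : ℂ ⊗[ℚ] V) :
    Qf.baseChange ℂ (HodgeStructure.conj x) (HodgeStructure.conj y) = starRingEnd ℂ (Qf.baseChange ℂ x y) := by
  induction x using TensorProduct.induction_on with
  | zero => simp
  | tmul a v =>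
    induction y using TensorProduct.induction_on with
    | zero => simp
    | tmul b w =>
      simp only [HodgeStructure.conj_tmul, LinearMap.BilinForm.baseChange_tmul, Rat.smul_def, map_mul, map_ratCast]
    | add y₁ y₂ h₁ h₂ => simp only [map_add, h₁, h₂]
  | add x₁ x₂ h₁ h₂ => simp only [map_add, LinearMap.add_apply, h₁, h₂]

/-- `conj` fixes the real vectors `1 ⊗ v`. [cite: VoisinHodgeI2002, §7.1.1] -/
theorem conj_one_tmul (v : V) : HodgeStructure.conj ((1 : ℂ) ⊗ₜ[ℚ] v) = (1 : ℂ) ⊗ₜ[ℚ] v := by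
  rw [HodgeStructure.conj_tmul, map_one]

/-- **The jet-span clause forces `A²E = E` for every class `E` paired to zero with the frame.** For a right-non-degenerate bilinear form
`Qf` on a `ℚ`-space `V`, a `Qf`-isometry `A` with `A⁴ = 1`, a map `ω : ℂ^N → ℂ ⊗ V`, an open `U ∋ z₀`, the jet-span clause of the member
certificates at `z₀` for the `i`-eigenspace of `A ⊗ ℂ`, and `E ∈ V` with `Qf_ℂ(ω z, 1 ⊗ E) = 0` on `U`: `A (A E) = E` (module docstring).
[cite: VoisinHodgeI2002, §7.1.1 and §10.2.1] -/
theorem sq_apply_eq_self_of_jetSpan {N : ℕ}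
    (Qf : LinearMap.BilinForm ℚ V) (hQ : ∀ y : V, (∀ x : V, Qf x y = 0) → y = 0)
    (A : V →ₗ[ℚ] V) (hA4 : ∀ v : V, A (A (A (A v))) = v) (hAQ : ∀ x y : V, Qf (A x) (A y) = Qf x y)
    {U : Set (Fin N → ℂ)} (hU : IsOpen U) {z₀ : Fin N → ℂ} (hz₀ : z₀ ∈ U)
    (ω : (Fin N → ℂ) → ℂ ⊗[ℚ] V) (r : ℕ)
    (hjet : ∀ φ : Module.Dual ℂ (ℂ ⊗[ℚ] V), (∀ i ≤ r, iteratedFDeriv ℂ i (fun z ↦ φ (ω z)) z₀ = 0) →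
      ∀ m ∈ Module.End.eigenspace (A.baseChange ℂ) Complex.I, φ m = 0)
    (E : V) (hE : ∀ z ∈ U, Qf.baseChange ℂ (ω z) ((1 : ℂ) ⊗ₜ[ℚ] E) = 0) :
    A (A E) = E := by
  -- the functional `φ_E = Qf_ℂ(·, 1 ⊗ E)`
  set φ : Module.Dual ℂ (ℂ ⊗[ℚ] V) := (Qf.baseChange ℂ).flip ((1 : ℂ) ⊗ₜ[ℚ] E) with hφdef
  have hφ : ∀ x, φ x = Qf.baseChange ℂ x ((1 : ℂ) ⊗ₜ[ℚ] E) := fun x => by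
    rw [hφdef]
    rfl
  -- all jets of `φ ∘ ω` vanish at `z₀`, so `φ` kills the `i`-eigenspace
  have hφω : (fun z ↦ φ (ω z)) =ᶠ[𝓝 z₀] (fun _ ↦ (0 : ℂ)) := by
    filter_upwards [hU.mem_nhds hz₀] with z hz
    rw [hφ, hE z hz]
  have hφM : ∀ m ∈ Module.End.eigenspace (A.baseChange ℂ) Complex.I, φ m = 0 := by
    refine hjet φ fun i _ => ?_
    rw [(hφω.iteratedFDeriv ℂ i).eq_of_nhds]
    simp
  -- `A ⊗ ℂ`
  set Ac : ℂ ⊗[ℚ] V →ₗ[ℂ] ℂ ⊗[ℚ] V := A.baseChange ℂ with hAc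
  -- Step 1: `Qf(v, E) = 0` for every `v` with `A² v = -v`
  have key : ∀ v : V, A (A v) = -v → Qf v E = 0 := by
    intro v hv
    set x : ℂ ⊗[ℚ] V := (1 : ℂ) ⊗ₜ[ℚ] v with hx
    have hAcx : Ac (Ac x) = -x := by
      simp only [hAc, hx, LinearMap.baseChange_tmul, hv, TensorProduct.tmul_neg]
    -- `y = x - i • Ac x` lies in the `i`-eigenspace
    have hy : x - Complex.I • Ac x ∈ Module.End.eigenspace Ac Complex.I := by
      rw [Module.End.mem_eigenspace_iff]
      rw [map_sub, map_smul, hAcx, smul_sub, smul_smul, Complex.I_mul_I, smul_neg, neg_smul, one_smul, sub_neg_eq_add,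
        sub_neg_eq_add, add_comm]
    have h1 : φ (x - Complex.I • Ac x) = 0 := hφM _ hy
    -- its conjugate is `x + i • Ac x`, and `φ` vanishes there too
    have hconj : HodgeStructure.conj (x - Complex.I • Ac x) = x + Complex.I • Ac x := by
      rw [map_sub, HodgeStructure.conj_smul, hAc, HodgeStructure.conj_baseChange, hx, conj_one_tmul, Complex.conj_I, neg_smul,
        sub_neg_eq_add]
    have h2 : φ (x + Complex.I • Ac x) = 0 := by
      rw [← hconj, hφ, ← conj_one_tmul E, baseChange_conj_conj, ← hφ, h1, map_zero]
    -- hence `φ x = 0`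
    have hsum : (x - Complex.I • Ac x) + (x + Complex.I • Ac x) = x + x := by abel
    have h3 : φ x + φ x = 0 := by rw [← map_add, ← hsum, map_add, h1, h2, add_zero]
    have h4 : φ x = 0 := add_self_eq_zero.mp h3
    -- and `φ x = Qf(v, E)`
    have h5 : φ x = ((Qf v E : ℚ) : ℂ) := by
      rw [hφ, hx, LinearMap.BilinForm.baseChange_tmul, mul_one, Rat.smul_one_eq_cast]
    rw [h5] at h4
    exact_mod_cast h4
  -- Step 2: `E₋ := E - A²E` is `Qf`-orthogonal to everything
  set Em : V := E - A (A E) with hEm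
  have hEm2 : A (A Em) = -Em := by
    simp only [hEm, map_sub, hA4]
    abel
  have hAQ2 : ∀ x y : V, Qf (A (A x)) (A (A y)) = Qf x y := fun x y => by rw [hAQ, hAQ]
  have horth : ∀ x : V, Qf x Em = 0 := by
    intro x
    -- `x₋ = x - A²x`, `x₊ = x + A²x`
    have hxm : A (A (x - A (A x))) = -(x - A (A x)) := by
      simp only [map_sub, hA4]
      abel
    have hxp : A (A (x + A (A x))) = x + A (A x) := by
      simp only [map_add, hA4]
      abel
    -- `Qf(x₋, E) = 0` and `Qf(x₋, A²E) = 0`, so `Qf(x₋, E₋) = 0`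
    have hm1 : Qf (x - A (A x)) E = 0 := key _ hxm
    have hm2 : Qf (x - A (A x)) (A (A E)) = 0 := by
      have h := hAQ2 (x - A (A x)) (A (A E))
      rw [hxm, hA4, map_neg, LinearMap.neg_apply, hm1, neg_zero] at h
      exact h.symm
    have hm : Qf (x - A (A x)) Em = 0 := by
      rw [hEm, map_sub, hm1, hm2, sub_zero]
    -- `Qf(x₊, E₋) = -Qf(x₊, E₋)`, so it vanishes
    have hp : Qf (x + A (A x)) Em = 0 := by
      have h := hAQ2 (x + A (A x)) Em
      rw [hxp, hEm2, map_neg] at h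
      have h' : Qf (x + A (A x)) Em + Qf (x + A (A x)) Em = 0 := by
        nth_rewrite 1 [← h]
        exact neg_add_cancel _
      exact add_self_eq_zero.mp h'
    -- `x + x = x₊ + x₋`
    have hsum : (x + A (A x)) + (x - A (A x)) = x + x := by abel
    have h2x : Qf x Em + Qf x Em = 0 := by
      rw [← LinearMap.add_apply, ← map_add, ← hsum, map_add, LinearMap.add_apply, hp, hm, add_zero]
    exact add_self_eq_zero.mp h2x
  have hEm0 : Em = 0 := hQ Em horth
  rw [hEm, sub_eq_zero] at hEm0
  exact hEm0.symm

end Summit.HodgeConjecture.HodgeConjecture.Theorems.Q8SymplecticPowersJetSpanForcesInvariant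

end
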